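import Mathlib
import HarnessLib
import Summits.HubbardSuperconductivity.HubbardSuperconductivity.Theorems.KLProgrammeC4aCausticWindowCover

/-!
# Route `KLProgramme` — crux C4a, S3 brick (B4) «(U1)-LAWS» part 5a: AT A FOLD POINT THE CAUSTIC DISTANCE IS CONTROLLED BY THE FOLD VALUE —
# `‖S − 2πm − 2Φ(0,χ)‖ ≤ C₀·|e_K(S − Φ(0,χ))|` whenever the loop slope vanishes at `χ` (Gauss law + chart point; no implicit function)

Cell `gate-hubbard-kl`, seat hubbard-kl-k3c3-p3 (g31; row «implicit-function / monotonicity route for μ(n)»).  Located brick for the (C)-closer lane / the (M4)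
assembly of the umklapp first-order ϑ-layer (stub (C) `stub_twoLeg_curvature` of `KLRegimeEngineV17F2`, stmt-HubbardSuperconductivity-20437), memo
HOME/hubbard-kl-k3c3-p3/U1-CAUSTIC-SUP.md §11 (the (N2) pre-side composition, geometric input).

WHY.  The pre-caustic (N2) law along a level line (`…C4aPreCausticLevelLine`) needs the deformation `r(e) = ē(e,v) − (D(v) − e)` of the partner band from the
anti-diagonal to be small, `|∂_eē + 1| ≤ η`, with `η ≲ η₁D(v) + η₂|v − v*|` VANISHING at the caustic configuration (a constant `η` would put `η/√δ₀` into the angle layer,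
not integrable through the antipodal double zero).  By `…C4aPartnerBandLevelRate.abs_deriv_partnerBand_level_add_one_le`, `η ≤ K₂·‖S − 2πm − 2Φ(e, v+θ)‖/(Dt−2A)` — the
CAUSTIC DISTANCE; over the box it moves by `2(|e|/(Dt−2A) + msD₁|v − v*|)` (`…C4aFoldBoxPartnerBand.norm_caustic_sub_two_smul_le`), so what is needed is its value AT the
level-`0` fold point `v*`: there the loop slope vanishes, and this file shows the distance is then `≤ C₀·|δ₀|`, `δ₀ = ē(0, v*)` the fold value (`≤ D(v)` on the pre side).
MECHANISM (this row's: no implicit function).  `P′ := S − 2πm − Φ(0,χ)` is within `Δ ≤ 3/10` of `p = Φ(0,χ)`, hence a chart point `P′ = Φ(δ, ψ′)` of its own level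
`δ = e_K(P′) = e_K(S − Φ(0,χ))` with `(2u/π)‖ψ′ − χ‖_𝕋 ≤ Δ` (`…C4aCausticWindowCover.exists_chart_of_norm_sub_levelPoint_le`); the GAUSS LAW
(`…C4aTransversalityGaussLaw.abs_fderiv_frameLevel_levelPoint_tangent_ge`) bounds `|De_K(Φ(δ,ψ′))[∂Φ(0,χ)]|` BELOW by `(2/π)(Dt−2A)u·((uw/(4+2A))·min(‖ψ′−χ‖_𝕋, ‖ψ′−χ−π‖_𝕋) − πKc|δ|/(Dt−2A)²)`,
and that derivative IS the loop slope (periodicity of `De_K`), i.e. zero; with `Δ ≤ u_min` the angle `‖ψ′ − χ‖_𝕋 ≤ π/2` is the smaller of the pair, so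
`‖ψ′ − χ‖_𝕋 ≤ π(4+2A)Kc|δ|/(uw(Dt−2A)²)`, and `‖P′ − p‖ ≤ |δ|/(Dt−2A) + msD₁‖ψ′ − χ‖_𝕋`.
* §1 `torusDist_pi_eq`, `pi_sub_torusDist_le` (torus bookkeeping); `deriv_partnerBand_angle_eq_neg_fderiv` (the loop slope is `−De_K(S − Φ)[∂Φ]`).
* §2 **`norm_caustic_le_of_tangent_slope_zero`** (HEADLINE): `‖S − 2πm − 2Φ(0,χ)‖ ≤ Δ ≤ min(3/10, u_min)`, `K₁Δ < r`, `De_K(S − Φ(0,χ))[∂Φ(0,χ)] = 0` ⟹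
  `‖S − 2πm − 2Φ(0,χ)‖ ≤ (1/(Dt−2A) + msD₁·π(4+2A)Kc/(u_min·w·(Dt−2A)²))·|e_K(S − Φ(0,χ))|`; **`norm_caustic_le_of_foldPoint`**: the same keyed to a fold point
  `y*` of the loop band `y ↦ e_K(S − Φ(0, y+θ))` (`deriv = 0`), `χ = y* + θ`.
Sizes binder shape of `…C4aCausticWindowCover` + `GeomConstants`; nothing asserts (C), K3 or superconductivity.
References: BGM 2003 §7.1 Lemma 7.1 [cite: BenfattoGiulianiMastropietro2003]; FST II CPAM 51 (1998) Lemma 2.1 [cite: FeldmanSalmhoferTrubowitz1998].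
-/

noncomputable section

namespace Summit.HubbardSuperconductivity.HubbardSuperconductivity.Theorems.C4a

set_option linter.dupNamespace false -- summit = problem name (single-conjunct summit), D-0017

open Real Set
open Literature.MathematicalPhysics.QuantumLattice Literature.MathematicalPhysics.QuantumLattice.BandSectorCounting
open Literature.MathematicalPhysics.QuantumLattice.FermiRG
open Summit.HubbardSuperconductivity.HubbardSuperconductivity.Theorems.KLRegimeSplit
open Summit.HubbardSuperconductivity.HubbardSuperconductivity.Theorems.DispersionFlow
open Summit.HubbardSuperconductivity.HubbardSuperconductivity.Theorems.PerturbedFermiCurve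

/-! ## §1 Torus bookkeeping; the loop slope as a directional derivative -/

/-- `‖π‖_𝕋 = π`. -/
theorem torusDist_pi_eq : torusDist π = π := by
  unfold FermiRG.torusDist
  have h := (AddCircle.norm_coe_eq_abs_iff (p := 2 * π) (x := π) Real.two_pi_pos.ne').2
    (by rw [abs_of_pos Real.pi_pos, abs_of_pos Real.two_pi_pos]; linarith [Real.pi_pos])
  rw [h, abs_of_pos Real.pi_pos]

/-- `π − ‖y‖_𝕋 ≤ ‖y − π‖_𝕋`. -/
theorem pi_sub_torusDist_le (y : ℝ) : π - torusDist y ≤ torusDist (y - π) := by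
  have h := torusDist_sub_torusDist_le_torusDist_add (-π) y
  rw [torusDist_neg', torusDist_pi_eq, show -π + y = y - π by ring] at h
  exact h

section Sizes

variable {K : TrigPolyC4v} {A : ℝ} (hA : ∀ p : Momentum, ∀ j ≤ 2, ‖iteratedFDeriv ℝ j (frameShift K) p‖ ≤ A) (hA20 : A ≤ 1 / 20)
  (hd : klCurveD ≤ (bandBounds (show (-4 : ℝ) < -1.1 by norm_num) (show (-1.1 : ℝ) ≤ -0.1 by norm_num)
    (show (-0.1 : ℝ) < 0 by norm_num)).Dtmin - 2 * A)
  {μ r : ℝ} (hr : 0 < r) (hlo : (-1.1 : ℝ) < μ - r - A) (hhi : μ + r + A < -0.1)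
  {A₃ A₄ : ℝ} (hA₃ : ∀ p : Momentum, ‖iteratedFDeriv ℝ 3 (frameShift K) p‖ ≤ A₃)
  (hA₄ : ∀ p : Momentum, ‖iteratedFDeriv ℝ 4 (frameShift K) p‖ ≤ A₄)
  {K₁ K₂ K₃ : ℝ} (hK₁ : ∀ p : Momentum, ‖fderiv ℝ (frameLevel μ K) p‖ ≤ K₁) (hK₂ : ∀ p : Momentum, ‖iteratedFDeriv ℝ 2 (frameLevel μ K) p‖ ≤ K₂)
  (hK₃ : ∀ p : Momentum, ‖iteratedFDeriv ℝ 3 (frameLevel μ K) p‖ ≤ K₃)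
include hA hA20 hd hr hlo hhi hA₃ hA₄ hK₁ hK₂ hK₃

omit hA20 hr hA₃ hA₄ hK₁ hK₂ hK₃ in
/-- **The loop slope is a directional derivative**: `∂_y e_K(S − Φ(e, y+θ)) = −De_K(S − Φ(e, y+θ))[∂Φ(e, y+θ)]` (`|e| < r`). -/
theorem deriv_partnerBand_angle_eq_neg_fderiv (S : Momentum) {e : ℝ} (he : |e| < r) (θ y : ℝ) :
    deriv (fun x : ℝ => frameLevel μ K (S - levelPoint μ K e (x + θ))) y =
      -(fderiv ℝ (frameLevel μ K) (S - levelPoint μ K e (y + θ)) (iteratedDeriv 1 (levelPoint μ K e) (y + θ))) := by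
  have hE : HasFDerivAt (frameLevel μ K) (fderiv ℝ (frameLevel μ K) (S - levelPoint μ K e (y + θ))) (S - levelPoint μ K e (y + θ)) :=
    (((EngineV8.contDiff_frameLevel μ K (n := 1)).differentiable one_ne_zero) _).hasFDerivAt
  have hq : HasDerivAt (fun x : ℝ => levelPoint μ K e (x + θ)) (iteratedDeriv 1 (levelPoint μ K e) (y + θ)) y :=
    HasDerivAt.comp_add_const y θ (hasDerivAt_levelPoint_angle hA hd hlo hhi he (y + θ))
  have hS : HasDerivAt (fun x : ℝ => S - levelPoint μ K e (x + θ)) (-iteratedDeriv 1 (levelPoint μ K e) (y + θ)) y := by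
    have h := hq.const_sub S
    simpa using h
  have h : HasDerivAt (frameLevel μ K ∘ fun x : ℝ => S - levelPoint μ K e (x + θ))
      (fderiv ℝ (frameLevel μ K) (S - levelPoint μ K e (y + θ)) (-iteratedDeriv 1 (levelPoint μ K e) (y + θ))) y := hE.comp_hasDerivAt y hS
  rw [show (fun x : ℝ => frameLevel μ K (S - levelPoint μ K e (x + θ))) = (frameLevel μ K ∘ fun x : ℝ => S - levelPoint μ K e (x + θ)) from rfl,
    h.deriv, map_neg]

/-! ## §2 The caustic distance at a point of vanishing loop slope -/

omit hK₂ hK₃ in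
/-- **AT A POINT OF VANISHING LOOP SLOPE THE CAUSTIC DISTANCE IS CONTROLLED BY THE BAND VALUE** (HEADLINE; see the module docstring).  `GeomConstants`; pair sum `S`,
sheet `m`, absolute loop angle `χ`; `‖S − 2πm − 2Φ(0,χ)‖ ≤ Δ` with `Δ ≤ 3/10`, `Δ ≤ u_min`, `K₁Δ < r`; and `De_K(S − Φ(0,χ))[∂Φ(0,χ)] = 0`.  THEN
`‖S − 2πm − 2Φ(0,χ)‖ ≤ (1/(Dt−2A) + msD₁·(π(4+2A)Kc/(u_min·w·(Dt−2A)²)))·|e_K(S − Φ(0,χ))|`. -/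
theorem norm_caustic_le_of_tangent_slope_zero {Kc r₀ g₀ w : ℝ} (hG : GeomConstants (frameLevel μ K) Kc r₀ g₀ w) (S : Momentum) (m : Fin 2 → ℤ) (χ : ℝ)
    {Δ : ℝ} (hDist : ‖S - WithLp.toLp 2 (fun i => 2 * π * (m i : ℝ)) - (2 : ℝ) • levelPoint μ K 0 χ‖ ≤ Δ) (hΔ : Δ ≤ 3 / 10)
    (hΔu : Δ ≤ (bandBounds (show (-4 : ℝ) < -1.1 by norm_num) (show (-1.1 : ℝ) ≤ -0.1 by norm_num) (show (-0.1 : ℝ) < 0 by norm_num)).umin) (hΔr : K₁ * Δ < r)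
    (hslope : fderiv ℝ (frameLevel μ K) (S - levelPoint μ K 0 χ) (iteratedDeriv 1 (levelPoint μ K 0) χ) = 0) :
    ‖S - WithLp.toLp 2 (fun i => 2 * π * (m i : ℝ)) - (2 : ℝ) • levelPoint μ K 0 χ‖ ≤
      (1 / ((bandBounds (show (-4 : ℝ) < -1.1 by norm_num) (show (-1.1 : ℝ) ≤ -0.1 by norm_num) (show (-0.1 : ℝ) < 0 by norm_num)).Dtmin - 2 * A) +
          msD A₃ A₄ 1 * (π * (4 + 2 * A) * Kc /
            ((bandBounds (show (-4 : ℝ) < -1.1 by norm_num) (show (-1.1 : ℝ) ≤ -0.1 by norm_num) (show (-0.1 : ℝ) < 0 by norm_num)).umin * w *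
              ((bandBounds (show (-4 : ℝ) < -1.1 by norm_num) (show (-1.1 : ℝ) ≤ -0.1 by norm_num) (show (-0.1 : ℝ) < 0 by norm_num)).Dtmin - 2 * A) ^ 2))) *
        |frameLevel μ K (S - levelPoint μ K 0 χ)| := by
  set B := bandBounds (show (-4 : ℝ) < -1.1 by norm_num) (show (-1.1 : ℝ) ≤ -0.1 by norm_num) (show (-0.1 : ℝ) < 0 by norm_num) with hBdef
  set v : Momentum := WithLp.toLp 2 (fun i => 2 * π * (m i : ℝ)) with hv
  set p : Momentum := levelPoint μ K 0 χ with hp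
  set P' : Momentum := S - v - p with hP'
  have hADt : 2 * A < B.Dtmin := by have := klCurveD_pos; linarith
  have hDt : 0 < B.Dtmin - 2 * A := by linarith
  have hu : 0 < B.umin := B.umin_pos
  have hw : 0 < w := hG.wmin_pos
  have hA0 : 0 ≤ A := (norm_nonneg _).trans (hA 0 0 (by norm_num))
  have hKc0 : 0 ≤ Kc := (norm_nonneg _).trans (hG.norm_iteratedFDeriv_le 0 0 (by norm_num))
  have hr' : 0 < r := lt_of_le_of_lt (mul_nonneg ((norm_nonneg _).trans (hK₁ 0)) ((norm_nonneg _).trans hDist)) hΔr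
  have h0r : |(0 : ℝ)| < r := by simpa using hr'
  have h0r₀ : |(0 : ℝ)| < r₀ := by simpa using hG.r₀_pos
  have hM : 0 ≤ msD A₃ A₄ 1 := (norm_nonneg _).trans (norm_iteratedDeriv_levelPoint_le hA hA20 hd hlo hhi hA₃ hA₄ h0r le_rfl (by norm_num) 0)
  -- the distance is `‖P′ − p‖`
  have hPp : S - v - (2 : ℝ) • p = P' - p := by rw [hP', two_smul]; abel
  rw [hPp] at hDist ⊢
  -- `P′` is a chart point of its own level `δ`
  obtain ⟨ψ', hPeq, hlev, hang⟩ := exists_chart_of_norm_sub_levelPoint_le hA hd hlo hhi hK₁ hDist hΔ hΔr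
  have hδ : frameLevel μ K P' = frameLevel μ K (S - p) := by rw [hP', show S - v - p = S - p - v by abel]; exact frameLevel_sub_twoPi μ K (S - p) m
  have hlevr : |frameLevel μ K P'| < r := lt_of_le_of_lt hlev hΔr
  -- the Gauss law at `P′ = Φ(δ, ψ′)` against the tangent at `χ` (level `0`)
  have hgauss := abs_fderiv_frameLevel_levelPoint_tangent_ge hA hd hlo hhi hG hlevr h0r h0r₀ ψ' χ
  rw [← hPeq, sub_zero] at hgauss
  -- that derivative is the loop slope, i.e. zero (periodicity of `De_K`)
  have hper : fderiv ℝ (frameLevel μ K) P' = fderiv ℝ (frameLevel μ K) (S - p) := by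
    have h := fderiv_frameLevel_add_period μ K (frameLevel_add_twoPi μ K m) (S - p - v)
    rw [sub_add_cancel] at h
    rw [hP', show S - v - p = S - p - v by abel]; exact h.symm
  rw [hper, hslope, abs_zero] at hgauss
  -- hence `min(‖ψ′−χ‖_𝕋, ‖ψ′−χ−π‖_𝕋) ≤ E`
  set E : ℝ := π * (4 + 2 * A) * Kc / (B.umin * w * (B.Dtmin - 2 * A) ^ 2) * |frameLevel μ K P'| with hE
  have hmin : min (torusDist (ψ' - χ)) (torusDist (ψ' - χ - π)) ≤ E := by
    have hpos : 0 < 2 / π * ((B.Dtmin - 2 * A) * B.umin) := by positivity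
    have h1 : B.umin * w / (4 + 2 * A) * min (torusDist (ψ' - χ)) (torusDist (ψ' - χ - π)) -
        π * Kc * |frameLevel μ K P'| / (B.Dtmin - 2 * A) ^ 2 ≤ 0 := by
      by_contra hneg
      push Not at hneg
      have := mul_pos hpos hneg
      linarith
    have hcoef : 0 < B.umin * w / (4 + 2 * A) := by positivity
    rw [sub_nonpos] at h1
    have h2 : min (torusDist (ψ' - χ)) (torusDist (ψ' - χ - π)) ≤ (π * Kc * |frameLevel μ K P'| / (B.Dtmin - 2 * A) ^ 2) / (B.umin * w / (4 + 2 * A)) :=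
      (le_div_iff₀' hcoef).2 h1
    refine h2.trans (le_of_eq ?_)
    rw [hE]
    field_simp
  -- `‖ψ′ − χ‖_𝕋 ≤ π/2`, so it is the smaller of the pair: `‖ψ′ − χ‖_𝕋 ≤ E`
  have hxle : torusDist (ψ' - χ) ≤ π / 2 := by
    have h1 : 2 * B.umin / π * torusDist (ψ' - χ) ≤ B.umin := hang.trans hΔu
    have h2 : torusDist (ψ' - χ) * (2 * B.umin) ≤ B.umin * π := by
      have := mul_le_mul_of_nonneg_right h1 Real.pi_pos.le
      calc torusDist (ψ' - χ) * (2 * B.umin) = 2 * B.umin / π * torusDist (ψ' - χ) * π := by field_simp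
        _ ≤ B.umin * π := this
    nlinarith
  have hx : torusDist (ψ' - χ) ≤ E := by
    rcases le_total (torusDist (ψ' - χ)) (torusDist (ψ' - χ - π)) with h | h
    · rw [min_eq_left h] at hmin; exact hmin
    · rw [min_eq_right h] at hmin
      have h3 := pi_sub_torusDist_le (ψ' - χ)
      have : torusDist (ψ' - χ) ≤ π / 2 := hxle
      linarith
  -- the distance: `‖P′ − p‖ ≤ ‖Φ(δ,ψ′) − Φ(0,ψ′)‖ + ‖Φ(0,ψ′) − Φ(0,χ)‖`
  have hlevI : frameLevel μ K P' ∈ Ioo (-r) r := ⟨(abs_lt.1 hlevr).1, (abs_lt.1 hlevr).2⟩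
  have h0I : (0 : ℝ) ∈ Ioo (-r) r := ⟨by linarith, hr'⟩
  have hrad : ‖levelPoint μ K (frameLevel μ K P') ψ' - levelPoint μ K 0 ψ'‖ ≤ |frameLevel μ K P'| / (B.Dtmin - 2 * A) := by
    have h := norm_levelPoint_sub_levelPoint_le B hA hADt hlo hhi hlevI h0I ψ'
    rwa [sub_zero] at h
  have hangd : ‖levelPoint μ K 0 ψ' - p‖ ≤ msD A₃ A₄ 1 * torusDist (ψ' - χ) := norm_levelPoint_sub_le_torusDist hA hA20 hd hlo hhi hA₃ hA₄ h0r ψ' χ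
  have hsplit : ‖P' - p‖ ≤ |frameLevel μ K P'| / (B.Dtmin - 2 * A) + msD A₃ A₄ 1 * E := by
    calc ‖P' - p‖ = ‖(levelPoint μ K (frameLevel μ K P') ψ' - levelPoint μ K 0 ψ') + (levelPoint μ K 0 ψ' - p)‖ := by
          rw [← hPeq]; congr 1; abel
      _ ≤ ‖levelPoint μ K (frameLevel μ K P') ψ' - levelPoint μ K 0 ψ'‖ + ‖levelPoint μ K 0 ψ' - p‖ := norm_add_le _ _
      _ ≤ |frameLevel μ K P'| / (B.Dtmin - 2 * A) + msD A₃ A₄ 1 * E := add_le_add hrad (hangd.trans (mul_le_mul_of_nonneg_left hx hM))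
  rw [hδ] at hsplit
  refine hsplit.trans (le_of_eq ?_)
  rw [hE, hδ]
  ring

omit hK₂ hK₃ in
/-- **THE SAME, KEYED TO A FOLD POINT OF THE LOOP BAND.**  If `y*` is a critical point of `y ↦ e_K(S − Φ(0, y+θ))` and `‖S − 2πm − 2Φ(0, y*+θ)‖ ≤ Δ` with
`Δ ≤ 3/10`, `Δ ≤ u_min`, `K₁Δ < r`, then `‖S − 2πm − 2Φ(0, y*+θ)‖ ≤ C₀·|e_K(S − Φ(0, y*+θ))|` with the `C₀` of `norm_caustic_le_of_tangent_slope_zero` — on the pre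
side the caustic distance at the level-`0` fold point is at most `C₀·δ₀`. -/
theorem norm_caustic_le_of_foldPoint {Kc r₀ g₀ w : ℝ} (hG : GeomConstants (frameLevel μ K) Kc r₀ g₀ w) (S : Momentum) (m : Fin 2 → ℤ) (θ : ℝ) {ys Δ : ℝ}
    (hcrit : deriv (fun x : ℝ => frameLevel μ K (S - levelPoint μ K 0 (x + θ))) ys = 0)
    (hDist : ‖S - WithLp.toLp 2 (fun i => 2 * π * (m i : ℝ)) - (2 : ℝ) • levelPoint μ K 0 (ys + θ)‖ ≤ Δ) (hΔ : Δ ≤ 3 / 10)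
    (hΔu : Δ ≤ (bandBounds (show (-4 : ℝ) < -1.1 by norm_num) (show (-1.1 : ℝ) ≤ -0.1 by norm_num) (show (-0.1 : ℝ) < 0 by norm_num)).umin) (hΔr : K₁ * Δ < r) :
    ‖S - WithLp.toLp 2 (fun i => 2 * π * (m i : ℝ)) - (2 : ℝ) • levelPoint μ K 0 (ys + θ)‖ ≤
      (1 / ((bandBounds (show (-4 : ℝ) < -1.1 by norm_num) (show (-1.1 : ℝ) ≤ -0.1 by norm_num) (show (-0.1 : ℝ) < 0 by norm_num)).Dtmin - 2 * A) +
          msD A₃ A₄ 1 * (π * (4 + 2 * A) * Kc /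
            ((bandBounds (show (-4 : ℝ) < -1.1 by norm_num) (show (-1.1 : ℝ) ≤ -0.1 by norm_num) (show (-0.1 : ℝ) < 0 by norm_num)).umin * w *
              ((bandBounds (show (-4 : ℝ) < -1.1 by norm_num) (show (-1.1 : ℝ) ≤ -0.1 by norm_num) (show (-0.1 : ℝ) < 0 by norm_num)).Dtmin - 2 * A) ^ 2))) *
        |frameLevel μ K (S - levelPoint μ K 0 (ys + θ))| := by
  have hr' : 0 < r := lt_of_le_of_lt (mul_nonneg ((norm_nonneg _).trans (hK₁ 0)) ((norm_nonneg _).trans hDist)) hΔr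
  have h0r : |(0 : ℝ)| < r := by simpa using hr'
  have hslope : fderiv ℝ (frameLevel μ K) (S - levelPoint μ K 0 (ys + θ)) (iteratedDeriv 1 (levelPoint μ K 0) (ys + θ)) = 0 := by
    have h := deriv_partnerBand_angle_eq_neg_fderiv hA hd hlo hhi S h0r θ ys
    rw [hcrit] at h
    linarith
  exact norm_caustic_le_of_tangent_slope_zero hA hA20 hd hr hlo hhi hA₃ hA₄ hK₁ hG S m (ys + θ) hDist hΔ hΔu hΔr hslope

end Sizes

end Summit.HubbardSuperconductivity.HubbardSuperconductivity.Theorems.C4a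

end
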